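import Literature.Computability.MetaComplexity.PolynomialCalculus
import Literature.Computability.Complexity.NullstellensatzPC
import Literature.Computability.MetaComplexity.PolynomialCalculusRestriction
import HarnessLib

/-!
# The polynomial calculus with the variable-multiplication rule (multilinear form): degree bridge to PC/F, restrictions

Third toolkit file toward the size–degree trade-off of Impagliazzo–Pudlák–Sgall
(`PolynomialCalculusSizeDegree.lean`).

The proof system of Clegg–Edmonds–Impagliazzo (1996) and Impagliazzo–Pudlák–Sgall (1999) is the
polynomial calculus whose multiplication rule multiplies a line by a VARIABLE, with all lines kept
in multilinear normal form (reduction modulo `x² - x` is implicit: "we may assume without loss of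
generality that all polynomials are multilinear").  We render it as an inductive derivability
predicate carrying an arbitrary LINE PROPERTY `P` (every line of the derivation must satisfy `P`):

* `MLPC.Derivable 𝓕 P f` — `f` has a derivation from the axioms `𝓕` (entering as `ml f`) by the
  rules `f, g ⊢ f + g`, `f ⊢ a • f` (`a ∈ K`) and `f ⊢ ml (x_j · f)`, all of whose lines satisfy
  `P`.  Taking `P = (deg ≤ d)` gives degree-`d` derivability; taking `P = (monomials ⊆ M)` for a
  finite set `M` of monomials expresses "a refutation all of whose monomials are among `M`", i.e.
  a refutation with at most `|M|` distinct monomials — the SIZE measure of the trade-off.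
* `MLPC.Derivable.pc` — THE DEGREE BRIDGE to `PC.DerivableInDegree` of `PolynomialCalculus.lean`
  (Krajíček's PC/F: arbitrary polynomial lines, explicit Boolean axioms, multiplication by
  arbitrary polynomials): a degree-`≤ d` multilinear derivation is a degree-`≤ d + 1` PC/F
  derivation (one extra degree to multiply by `x_j` before reducing `x_j²`; the reduction
  `p ⊢ ml p` inside the degree of `p` is `pc_derivableInDegree_ml`).  Hence degree LOWER bounds
  for PC/F are degree lower bounds for the multilinear calculus.  (Conversely a PC/F derivation
  with the variable rule multilinearises line by line without raising degrees — not needed here.)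
* `MLPC.Derivable.restrict` — restricting every line by `x_j := b` (`b ∈ {0,1}`) turns a
  derivation from `𝓕` into one from `𝓕|_{x_j:=b}` (`MLPC.restrictSet`), transporting any line
  property compatible with restriction (Clegg–Edmonds–Impagliazzo's restriction argument).
* `MLPC.Derivable.sum_smul` — linear combinations inside a degree bound.

References: M. Clegg, J. Edmonds, R. Impagliazzo, *Using the Groebner basis algorithm to find
proofs of unsatisfiability*, Proc. 28th STOC (1996) 174–183; R. Impagliazzo, P. Pudlák,
J. Sgall, Comput. Complexity 8 (1999) 127–144 [ImpagliazzoPudlakSgall1999];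
J. Krajíček, *Proof Complexity* (2019) §6.2 (PC/F), Thm. 16.2.4 [KrajicekProofComplexity2019].

Design notes: no proof objects (sequences of lines) are introduced — "a refutation whose lines
all satisfy `P`" is exactly derivability of `1` in the inductive closure with side condition `P`,
as for `PC.DerivableInDegree`; size statements quantify over the finite set of monomials used.
Scalars: the rule `f ⊢ a • f` (the papers allow linear combinations).  No Boolean-axiom rule is
needed: `ml` builds the Boolean axioms in.
-/

noncomputable section

namespace Literature.Computability.MetaComplexity

open Finset MvPolynomial Literature.Computability.Complexity

variable {σ : Type*} {K : Type*} [Field K]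

namespace MLPC

/-! ### Reduction to multilinear form inside PC/F -/

/-- **A monomial reduces to its multilinear part inside its own degree**: for an exponent vector
`s` of degree `≤ e` with `mlMon s ≠ s`, the binomial `x^{mlMon s} - x^s` has a PC/F derivation of
degree `≤ e` from the Boolean axioms alone (peel off one square at a time:
`x^{u+e_j} - x^{u+2e_j} = -(x_j² - x_j)·x^u`). [Krajíček 2019, §6.2; Impagliazzo–Pudlák–Sgall
1999] [folklore] -/
theorem pc_derivableInDegree_mlMon_sub (𝓕 : Set (MvPolynomial σ K)) (e : ℕ) :
    ∀ (n : ℕ) (s : σ →₀ ℕ), s.degree ≤ n → s.degree ≤ e → mlMon s ≠ s →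
      PC.DerivableInDegree 𝓕 e (monomial (mlMon s) (1 : K) - monomial s 1) := by
  classical
  intro n
  induction n with
  | zero =>
    intro s hn _ hs
    exfalso
    apply hs
    rw [(Finsupp.degree_eq_zero_iff s).1 (Nat.le_zero.1 hn)]
    ext i; simp
  | succ n ih =>
    intro s hn he hs
    -- a variable with exponent ≥ 2
    obtain ⟨j, hj⟩ : ∃ j, 2 ≤ s j := by
      by_contra hcon
      push Not at hcon
      exact hs ((mlMon_eq_self_iff s).2 fun i => Nat.lt_succ_iff.1 (hcon i))
    have h2deg : 2 ≤ s.degree := by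
      rw [Finsupp.degree_apply]
      exact hj.trans (Finset.single_le_sum (fun _ _ => Nat.zero_le _)
        (Finsupp.mem_support_iff.2 (by omega)))
    obtain ⟨k, hk⟩ : ∃ k, s j = k + 2 := ⟨s j - 2, by omega⟩
    -- `s = u + 2 e_j`
    obtain ⟨u, hs_eq⟩ : ∃ u : σ →₀ ℕ, s = u + Finsupp.single j 2 :=
      ⟨s.erase j + Finsupp.single j k, by
        rw [add_assoc, ← Finsupp.single_add, ← hk, Finsupp.erase_add_single]⟩
    set s' : σ →₀ ℕ := u + Finsupp.single j 1 with hs'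
    have hml : mlMon s' = mlMon s := by
      rw [hs_eq, hs']
      ext i
      simp only [mlMon_apply, Finsupp.add_apply, Finsupp.single_apply]
      split <;> omega
    have hdeg' : s'.degree + 1 = s.degree := by
      simp only [hs_eq, hs', map_add, Finsupp.degree_single]
    -- the Boolean step: `x^{s'} - x^{s} = -(x_j² - x_j) · x^u`
    have hbool : PC.DerivableInDegree 𝓕 e (monomial s' (1 : K) - monomial s 1) := by
      have hXdeg : ((X j ^ 2 - X j : MvPolynomial σ K)).totalDegree ≤ e := by
        refine (totalDegree_sub _ _).trans (max_le ?_ ?_)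
        · rw [totalDegree_X_pow]; omega
        · rw [totalDegree_X]; omega
      have hprod : (X j ^ 2 - X j : MvPolynomial σ K) * monomial u (-1) =
          monomial s' (1 : K) - monomial s 1 := by
        rw [map_neg, mul_neg, sub_mul, X_pow_eq_monomial, X, monomial_mul, monomial_mul, hs_eq, hs',
          add_comm u, add_comm u]
        simp only [mul_one, neg_sub]
      have hpdeg : ((X j ^ 2 - X j : MvPolynomial σ K) * monomial u (-1)).totalDegree ≤ e := by
        rw [hprod]
        refine (totalDegree_sub _ _).trans (max_le ?_ ?_)
        · refine (totalDegree_monomial_le _ _).trans ?_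
          rw [sum_id_eq_degree]; omega
        · refine (totalDegree_monomial_le _ _).trans ?_
          rw [sum_id_eq_degree]; omega
      have := PC.DerivableInDegree.mul (monomial u (-1 : K))
        (PC.DerivableInDegree.booleanAxiom (𝓕 := 𝓕) j hXdeg) hpdeg
      rwa [hprod] at this
    by_cases hs'ml : mlMon s' = s'
    · rw [← hml, hs'ml]; exact hbool
    · have hih := ih s' (by omega) (by omega) hs'ml
      rw [hml] at hih
      have : monomial (mlMon s) (1 : K) - monomial s 1 =
          (monomial (mlMon s) 1 - monomial s' 1) + (monomial s' 1 - monomial s 1) := by ring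
      rw [this]
      exact .add hih hbool

/-- **PC/F reduces any line to its multilinear form within the line's degree**: if `p` has a
degree-`≤ e` PC/F derivation then so does `ml p` (`ml p = p + Σ_s c_s (x^{mlMon s} - x^s)`).
[Krajíček 2019, §6.2; Impagliazzo–Pudlák–Sgall 1999] [folklore] -/
theorem pc_derivableInDegree_ml {𝓕 : Set (MvPolynomial σ K)} {e : ℕ} {p : MvPolynomial σ K}
    (hp : PC.DerivableInDegree 𝓕 e p) : PC.DerivableInDegree 𝓕 e (ml K p) := by
  classical
  have hdeg : p.totalDegree ≤ e := hp.totalDegree_le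
  set S := p.support.filter fun s => mlMon s ≠ s with hS
  have hall : ml K p = p + ∑ s ∈ p.support, coeff s p • (monomial (mlMon s) (1 : K) - monomial s 1) := by
    have h1 : ∑ s ∈ p.support, coeff s p • (monomial (mlMon s) (1 : K) - monomial s 1) =
        (∑ s ∈ p.support, monomial (mlMon s) (coeff s p)) -
          ∑ s ∈ p.support, monomial s (coeff s p) := by
      rw [← Finset.sum_sub_distrib]
      refine Finset.sum_congr rfl fun s _ => ?_
      rw [smul_sub, smul_monomial, smul_monomial, smul_eq_mul, mul_one]
    rw [h1, ← ml_eq_sum, ← p.as_sum]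
    abel
  have hml : ml K p = p + ∑ s ∈ S, coeff s p • (monomial (mlMon s) (1 : K) - monomial s 1) := by
    rw [hS, Finset.sum_filter_of_ne]
    · exact hall
    · intro s _ hne heq
      apply hne
      rw [heq, sub_self, smul_zero]
  by_cases hSe : S = ∅
  · rw [hml, hSe, Finset.sum_empty, add_zero]; exact hp
  rw [hml]
  refine .add hp (PC.derivableInDegree_sum _ (Finset.nonempty_iff_ne_empty.2 hSe) fun s hs => ?_)
  rw [hS, Finset.mem_filter] at hs
  refine PC.DerivableInDegree.smul ?_ _
  have hsdeg : s.degree ≤ e := by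
    rw [← sum_exponents_eq_degree]; exact (le_totalDegree hs.1).trans hdeg
  exact pc_derivableInDegree_mlMon_sub 𝓕 e _ s le_rfl hsdeg hs.2

/-! ### The multilinear polynomial calculus with a line property -/

/-- **The polynomial calculus in multilinear representation with multiplication by variables**
(Clegg–Edmonds–Impagliazzo 1996 / Impagliazzo–Pudlák–Sgall 1999), as derivability subject to a
LINE PROPERTY `P`: `Derivable 𝓕 P f` says that `f` is obtained from the axioms `g ∈ 𝓕`
(entering in multilinear form `ml g`) by the rules `f, g ⊢ f + g`, `f ⊢ a • f` and
`f ⊢ ml (x_j · f)` (multiply by a variable and reduce modulo `x² = x`), every line of the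
derivation — axioms included — satisfying `P`.  (Boolean axioms are built into `ml`; a derivation
of `1` is a refutation of `𝓕`.) [Clegg–Edmonds–Impagliazzo 1996; Impagliazzo–Pudlák–Sgall
1999] [cite: ImpagliazzoPudlakSgall1999, §1–2 (the calculus of Clegg–Edmonds–Impagliazzo 1996)] -/
inductive Derivable (𝓕 : Set (MvPolynomial σ K)) (P : MvPolynomial σ K → Prop) :
    MvPolynomial σ K → Prop
  /-- an axiom, in multilinear form -/
  | hyp {g : MvPolynomial σ K} : g ∈ 𝓕 → P (ml K g) → Derivable 𝓕 P (ml K g)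
  /-- addition of two lines -/
  | add {f g : MvPolynomial σ K} : Derivable 𝓕 P f → Derivable 𝓕 P g → P (f + g) →
      Derivable 𝓕 P (f + g)
  /-- a scalar multiple of a line -/
  | smul {f : MvPolynomial σ K} (a : K) : Derivable 𝓕 P f → P (a • f) →
      Derivable 𝓕 P (a • f)
  /-- multiplication of a line by a variable, followed by multilinearisation -/
  | mulVar {f : MvPolynomial σ K} (j : σ) : Derivable 𝓕 P f → P (ml K (X j * f)) →
      Derivable 𝓕 P (ml K (X j * f))

variable {𝓕 : Set (MvPolynomial σ K)} {P Q : MvPolynomial σ K → Prop} {f : MvPolynomial σ K}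

/-- The last line satisfies the line property. [folklore] -/
theorem Derivable.prop (h : Derivable 𝓕 P f) : P f := by
  cases h with
  | hyp _ hP => exact hP
  | add _ _ hP => exact hP
  | smul _ _ hP => exact hP
  | mulVar _ _ hP => exact hP

/-- Every derivable line is multilinear. [Impagliazzo–Pudlák–Sgall 1999] [folklore] -/
theorem Derivable.ml_eq (h : Derivable 𝓕 P f) : ml K f = f := by
  induction h with
  | hyp _ _ => exact ml_ml _
  | add _ _ _ ihf ihg => rw [map_add, ihf, ihg]
  | smul a _ _ ih => rw [map_smul, ih]
  | mulVar _ _ _ _ => exact ml_ml _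

/-- Weakening the line property (the new property may use multilinearity of the lines).
[folklore] -/
theorem Derivable.mono (h : Derivable 𝓕 P f) (hPQ : ∀ g, ml K g = g → P g → Q g) :
    Derivable 𝓕 Q f := by
  induction h with
  | hyp hg hP => exact .hyp hg (hPQ _ (ml_ml _) hP)
  | add hf hg hP ihf ihg =>
    exact .add ihf ihg (hPQ _ (by rw [map_add, hf.ml_eq, hg.ml_eq]) hP)
  | smul a hf hP ih => exact .smul a ih (hPQ _ (by rw [map_smul, hf.ml_eq]) hP)
  | mulVar j _ hP ih => exact .mulVar j ih (hPQ _ (ml_ml _) hP)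

/-- Subtraction of lines (inside a degree bound). [folklore] -/
theorem Derivable.sub_of_degree {d : ℕ} {f g : MvPolynomial σ K}
    (hf : Derivable 𝓕 (fun h => h.totalDegree ≤ d) f)
    (hg : Derivable 𝓕 (fun h => h.totalDegree ≤ d) g) :
    Derivable 𝓕 (fun h => h.totalDegree ≤ d) (f - g) := by
  have hneg : Derivable 𝓕 (fun h => h.totalDegree ≤ d) ((-1 : K) • g) :=
    .smul (-1) hg (by rw [neg_one_smul, totalDegree_neg]; exact hg.prop)
  have := Derivable.add hf hneg (by
    rw [neg_one_smul, ← sub_eq_add_neg]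
    exact (totalDegree_sub _ _).trans (max_le hf.prop hg.prop))
  rwa [neg_one_smul, ← sub_eq_add_neg] at this

/-- **Linear combinations inside a degree bound**: `Σ_{i ∈ s} a_i • f_i` is derivable with all
lines of degree `≤ d` if every `f_i` is (`s` nonempty). [folklore] -/
theorem Derivable.sum_smul {d : ℕ} {ι : Type*} {s : Finset ι} (hs : s.Nonempty)
    (t : ι → MvPolynomial σ K) (a : ι → K)
    (h : ∀ i ∈ s, Derivable 𝓕 (fun g => g.totalDegree ≤ d) (t i)) :
    Derivable 𝓕 (fun g => g.totalDegree ≤ d) (∑ i ∈ s, a i • t i) := by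
  classical
  induction hs using Finset.Nonempty.cons_induction with
  | singleton i =>
    rw [Finset.sum_singleton]
    have hi := h i (Finset.mem_singleton_self i)
    exact .smul (a i) hi ((totalDegree_smul_le _ _).trans hi.prop)
  | cons i s hi hs ih =>
    rw [Finset.sum_cons]
    have h1 := h i (Finset.mem_cons_self i s)
    have h2 := ih fun k hk => h k (Finset.mem_cons_of_mem hk)
    have hsm : Derivable 𝓕 (fun g => g.totalDegree ≤ d) (a i • t i) :=
      .smul (a i) h1 ((totalDegree_smul_le _ _).trans h1.prop)
    exact .add hsm h2 ((totalDegree_add _ _).trans (max_le hsm.prop h2.prop))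

/-! ### The degree bridge to PC/F -/

/-- **A degree-`≤ d` multilinear derivation is a degree-`≤ d + 1` PC/F derivation** (Krajíček's
PC/F, `PC.DerivableInDegree`: explicit Boolean axioms, multiplication by arbitrary polynomials),
provided the axioms themselves have degree `≤ d + 1`: the rule `f ⊢ ml (x_j f)` is simulated by
`f ⊢ x_j f` (degree `+1`) followed by the reduction of `x_j²` inside that degree.
[Impagliazzo–Pudlák–Sgall 1999; Krajíček 2019, §6.2] [folklore] -/
theorem Derivable.pc {d : ℕ} (h : Derivable 𝓕 (fun g => g.totalDegree ≤ d) f)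
    (h𝓕 : ∀ g ∈ 𝓕, g.totalDegree ≤ d + 1) : PC.DerivableInDegree 𝓕 (d + 1) f := by
  induction h with
  | hyp hg _ => exact pc_derivableInDegree_ml (.hyp hg (h𝓕 _ hg))
  | add _ _ _ ihf ihg => exact .add ihf ihg
  | smul a _ _ ih => exact ih.smul a
  | @mulVar f j hf _ ih =>
    have hdeg : (f * X j).totalDegree ≤ d + 1 :=
      (totalDegree_mul _ _).trans (by rw [totalDegree_X]; exact Nat.add_le_add_right hf.prop 1)
    have := pc_derivableInDegree_ml (PC.DerivableInDegree.mul (X j) ih hdeg)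
    rwa [mul_comm] at this

/-- **Refutations transfer**: a multilinear refutation of degree `≤ d` of axioms of degree
`≤ d + 1` yields `PC.RefutableInDegree 𝓕 (d + 1)`.  Contrapositively, PC/F degree lower bounds
bound the degree of multilinear refutations from below. [Impagliazzo–Pudlák–Sgall 1999;
Krajíček 2019, §6.2] [folklore] -/
theorem refutableInDegree_of_derivable_one {d : ℕ}
    (h : Derivable 𝓕 (fun g => g.totalDegree ≤ d) 1) (h𝓕 : ∀ g ∈ 𝓕, g.totalDegree ≤ d + 1) :
    PC.RefutableInDegree 𝓕 (d + 1) :=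
  h.pc h𝓕

/-! ### Restricting a derivation -/

variable [DecidableEq σ]

/-- The restricted axiom set `𝓕|_{x_j := b} = {g|_{x_j:=b} : g ∈ 𝓕}`. [Impagliazzo–Pudlák–Sgall
1999] [folklore] -/
def restrictSet (j : σ) (b : Bool) (𝓕 : Set (MvPolynomial σ K)) : Set (MvPolynomial σ K) :=
  restrictVar K j b '' 𝓕

/-- Restricting an axiom set that does not mention `x_j` changes nothing. [folklore] -/
theorem restrictSet_eq_self_of_notMem_vars {j : σ} (b : Bool)
    (h : ∀ g ∈ 𝓕, j ∉ g.vars) : restrictSet j b 𝓕 = 𝓕 := by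
  ext g
  constructor
  · rintro ⟨g', hg', rfl⟩
    rwa [restrictVar_eq_self_of_notMem_vars (h g' hg')]
  · intro hg
    exact ⟨g, hg, restrictVar_eq_self_of_notMem_vars (h g hg) b⟩

/-- Degrees in a restricted axiom set. [folklore] -/
theorem totalDegree_le_of_mem_restrictSet {j : σ} {b : Bool} {e : ℕ}
    (h : ∀ g ∈ 𝓕, g.totalDegree ≤ e) {g : MvPolynomial σ K} (hg : g ∈ restrictSet j b 𝓕) :
    g.totalDegree ≤ e := by
  obtain ⟨g', hg', rfl⟩ := hg
  exact (totalDegree_restrictVar_le j b g').trans (h g' hg')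

/-- Variables in a restricted axiom set. [folklore] -/
theorem vars_subset_of_mem_restrictSet {j : σ} {b : Bool} {V : Finset σ}
    (h : ∀ g ∈ 𝓕, g.vars ⊆ V) {g : MvPolynomial σ K} (hg : g ∈ restrictSet j b 𝓕) :
    g.vars ⊆ V := by
  obtain ⟨g', hg', rfl⟩ := hg
  exact (vars_restrictVar_subset j b g').trans (h g' hg')

/-- **Restriction of a derivation** (Clegg–Edmonds–Impagliazzo): applying `x_j := b` to every line
of a derivation from `𝓕` gives a derivation from `𝓕|_{x_j:=b}`; a line property `P` is carried
to any `Q` that holds for restrictions of multilinear `P`-lines.  (The rule `f ⊢ ml (x_j f)` for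
the restricted variable becomes the scalar rule `f ⊢ b • f`.) [Clegg–Edmonds–Impagliazzo 1996;
Impagliazzo–Pudlák–Sgall 1999] [folklore] -/
theorem Derivable.restrict (j : σ) (b : Bool)
    (hPQ : ∀ g, ml K g = g → P g → Q (restrictVar K j b g)) (h : Derivable 𝓕 P f) :
    Derivable (restrictSet j b 𝓕) Q (restrictVar K j b f) := by
  induction h with
  | @hyp g hg hP =>
    have := hPQ _ (ml_ml g) hP
    rw [← ml_restrictVar] at this ⊢
    exact .hyp ⟨g, hg, rfl⟩ this
  | add hf hg hP ihf ihg =>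
    have := hPQ _ (by rw [map_add, hf.ml_eq, hg.ml_eq]) hP
    rw [map_add] at this ⊢
    exact .add ihf ihg this
  | smul a hf hP ih =>
    have := hPQ _ (by rw [map_smul, hf.ml_eq]) hP
    rw [map_smul] at this ⊢
    exact .smul a ih this
  | @mulVar f i hf hP ih =>
    have hQ := hPQ _ (ml_ml _) hP
    have hfml : ml K (restrictVar K j b f) = restrictVar K j b f :=
      ml_restrictVar_of_ml_eq_self hf.ml_eq j b
    rw [← ml_restrictVar, map_mul] at hQ ⊢
    by_cases hij : i = j
    · subst hij
      have hc : ml K (restrictVar K i b (X i) * restrictVar K i b f) =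
          (if b then (1 : K) else 0) • restrictVar K i b f := by
        rw [restrictVar_X_self]
        cases b
        · simp
        · simp [hfml]
      rw [hc] at hQ ⊢
      exact .smul _ ih hQ
    · rw [restrictVar_X_ne hij] at hQ ⊢
      exact .mulVar i ih hQ

end MLPC

end Literature.Computability.MetaComplexity
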